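import Summits.QuantumFields.BalabanUV.Beta.TorusBoxProfile
import Summits.QuantumFields.BalabanUV.Beta.MultiscaleDistanceGraded

/-!
# `Summit.QuantumFields.BalabanUV.Beta.MultiscaleBoxDistance` — engine file 16a: a COORDINATE BOX OF THE UNIT TORUS LIES IN THE
# SCALE-ADAPTED BALL — under beta-d4-p2's sitewise ADDITIVE grading `|e(x) − e(y)| ≤ A + d_n(x,y)/R` of the scale `n = L^e`, every
# `x` with `dist(x, x₀) ≤ r` has `d_n(x, x₀) ≤ d·r·Γ/n(x₀)`, `Γ = L^A·e^{(log L/R)·ρ₀}`, as long as `d·r·Γ/n(x₀) ≤ ρ₀` (the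
# geometric half of the owner's assembly of file 9b's local-regularity datum `hreg` for `levelOp` from the mean-value binder; file 16b)

HONEST FRAMING (page 1 of everything in this cell).  Discharging `FlowStep.BetaPertH` would make Bałaban's ultraviolet
stability UNCONDITIONAL — a constructive-QFT result; it is NOT the continuum limit and NOT the Clay problem.  This module
discharges nothing of `BetaPertH`; it is [folklore] lattice bookkeeping, kernel-checked, by the OWNER of binder row D4 (unit
`b2b-balaban-beta-an4`, gen 45).  HONEST DEPENDENCY: continuum YM on T⁴ ⇐ BetaPertH ∧ nine spine estimates (0/9 proved);
BetaPertH ⇐ (D1) ∧ (D4) ∧ CAP+tail; G-an2-4 gates asym, D1 and NE2/3/4.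

THE POINT.  File 9b's datum `hreg` is phrased on the `d_n`-BALL `{q : d_n(q, x) ≤ ρ₀}` of beta-d4-p2's scale-adapted distance
(`MultiscaleDistance.sdist`: a bond costs `min(1/n(b₋), 1/n(b₊))`), while the unit supersolution of file 15b and the mean-value
binder live on COORDINATE BOXES `{y : dist(y, x) ≤ r}` of the torus.  This file walks from the centre to any point of the box
along the axes, one unit step at a time (the circular ℓ¹-distance `Σ_μ δ_μ(y, x₀)` drops by one at each step —
`exists_step_down`), paying `≤ 1/n(y′) ≤ Γ/n(x₀)` per step as long as the walk stays in the `d_n`-ball of radius `ρ₀` (where the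
grading bounds the scale from below: `scale_ge_of_sdist_le`).  Result (**`sdist_le_of_dist_le`**): `dist(x, x₀) ≤ r` and
`d·r·Γ/n(x₀) ≤ ρ₀` ⟹ `d_n(x, x₀) ≤ d·r·Γ/n(x₀)`; so a box of side `≍ n(x₀)` sits inside a `d_n`-ball of radius `O(1)` — the
sandwich the assembly (file 16b) needs, with constants seeing `d, L, A, R, ρ₀` only.

WHAT IS CERTIFIED (kernel, 0 sorry, 0 def): §1 `circAbs_descent` (one of the two unit steps lowers a positive circular distance
by one), `eq_of_cdist_eq_zero` (all circular coordinate distances vanish ⟹ the points coincide), `sum_cdist_le_of_dist_le`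
(`Σ_μ δ_μ ≤ d·r` in the box); §2 `exists_step_down` (a bond into or out of `x` whose other end is one unit closer to `x₀` in
circular ℓ¹-distance); §3 (general scale `n = L^e` on the torus with the additive grading) `scale_ge_of_sdist_le`
(`d_n(y,x₀) ≤ ρ₀ ⟹ n(x₀) ≤ Γ·n(y)`), **`sdist_le_of_sum_cdist_le`** (the induction on the circular ℓ¹-distance),
**`sdist_le_of_dist_le`** (the box corollary).  LOCATORS (shape only; ABSOLUTE RULE — nothing printed is asserted):
[Balaban1984PropagatorsII] (2.46) p. 231 (the weighted distance); [Balaban1985BackgroundPropagators] Thm 3.1 (3.42) p. 397.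
Row D4: NO class change (critical-path width 0; D4 DISCHARGE NO DATE); NOT BetaPertH, NOT continuum, NOT Clay, NOT summit progress.
-/

open scoped BigOperators
open Finset

namespace Summit.QuantumFields.BalabanUV.Beta.MultiscaleBoxDistance

open Literature.MathematicalPhysics.QuantumFieldTheory.Balaban1983to89
open Literature.MathematicalPhysics.QuantumFieldTheory.Balaban1983to89.B9Thm37GluePU (bsrc btgt bsrc_apply btgt_apply)
open B4TorusKernel.MultiPeriod (circAbs centre circAbs_nonneg circAbs_le_abs circAbs_add_mul abs_add_mul_centre
  two_mul_circAbs_le)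
open B4Sect5Torus (TSite)
open B5TorusCover (UT)
open B5Leibniz121 (up dn up_dn)
open Summit.QuantumFields.BalabanUV.Beta.MultiscaleDistance
open Summit.QuantumFields.BalabanUV.Beta.MultiscaleDistanceGraded (scale_le_scale_mul_exp_add)
open Summit.QuantumFields.BalabanUV.Beta.TorusBoxProfile

noncomputable section

/-! ## §1 Circular arithmetic: descent, definiteness, the circular ℓ¹-distance in a box -/

/-- **Descent**: if `dist(t, Mℤ) ≥ 1` then one of the two unit steps lowers it by one:
`dist(t+1, Mℤ) = dist(t, Mℤ) − 1` or `dist(t−1, Mℤ) = dist(t, Mℤ) − 1`. [folklore] -/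
theorem circAbs_descent {M : ℕ} (hM : 1 ≤ M) (t : ℤ) (ht : 1 ≤ circAbs M t) :
    circAbs M (t + 1) = circAbs M t - 1 ∨ circAbs M (t - 1) = circAbs M t - 1 := by
  set s : ℤ := t + M * centre M t with hs
  have habs : |s| = circAbs M t := abs_add_mul_centre hM t
  have hM2 : 2 * circAbs M t ≤ (M : ℤ) := two_mul_circAbs_le M t
  have h1 : circAbs M (t + 1) = circAbs M (s + 1) := by
    rw [hs, show t + (M : ℤ) * centre M t + 1 = (t + 1) + (M : ℤ) * centre M t by ring, circAbs_add_mul]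
  have h2 : circAbs M (t - 1) = circAbs M (s - 1) := by
    rw [hs, show t + (M : ℤ) * centre M t - 1 = (t - 1) + (M : ℤ) * centre M t by ring, circAbs_add_mul]
  rcases le_or_gt 1 s with hpos | hneg
  · right
    rw [h2, ← habs, circAbs_eq_abs_of_two_mul_abs_le hM (s - 1) (by rw [abs_of_nonneg (by omega)]; rw [abs_of_pos (by omega)] at habs; omega),
      abs_of_nonneg (by omega), abs_of_pos (by omega)]
  · left
    have hs1 : s ≤ -1 := by
      rcases le_or_gt s (-1) with h | h
      · exact h
      · exfalso
        have : |s| = 0 := by rw [abs_eq_zero]; omega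
        rw [this] at habs; omega
    rw [h1, ← habs, circAbs_eq_abs_of_two_mul_abs_le hM (s + 1) (by rw [abs_of_nonpos (by omega)]; rw [abs_of_neg (by omega)] at habs; omega),
      abs_of_nonpos (by omega), abs_of_neg (by omega)]
    ring

section Torus

variable {d : ℕ} {N : Fin d → ℕ} [∀ i, NeZero (N i)]

/-- **Definiteness**: if every circular coordinate distance between `x` and `x₀` vanishes then `x = x₀`. [folklore] -/
theorem eq_of_cdist_eq_zero {x x₀ : UT N}
    (h : ∀ μ, circAbs (N μ) (((UT.toSite N x μ).val : ℤ) - ((UT.toSite N x₀ μ).val : ℤ)) = 0) : x = x₀ := by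
  have key : ∀ μ, UT.toSite N x μ = UT.toSite N x₀ μ := by
    intro μ
    have hμ := h μ
    have hN1 : (1 : ℤ) ≤ (N μ : ℤ) := by exact_mod_cast UT.one_le N μ
    set u : ℤ := ((UT.toSite N x μ).val : ℤ) - ((UT.toSite N x₀ μ).val : ℤ) with hu
    have hlt1 := (UT.toSite N x μ).isLt
    have hlt2 := (UT.toSite N x₀ μ).isLt
    have hmod0 : u % (N μ : ℤ) = 0 := by
      have hml : u % (N μ : ℤ) < N μ := Int.emod_lt_of_pos _ (by omega)
      have hm0 : 0 ≤ u % (N μ : ℤ) := Int.emod_nonneg _ (by omega)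
      unfold circAbs at hμ
      rcases min_choice (u % (N μ : ℤ)) ((N μ : ℤ) - u % (N μ : ℤ)) with hc | hc <;> rw [hc] at hμ <;> omega
    have hdvd : (N μ : ℤ) ∣ u := Int.dvd_of_emod_eq_zero hmod0
    have hu0 : u = 0 := Int.eq_zero_of_abs_lt_dvd hdvd (by rw [hu, abs_lt]; constructor <;> omega)
    exact Fin.ext (by omega)
  exact funext key

/-- In the box `dist(x, x₀) ≤ r` the circular ℓ¹-distance is `≤ d·r`. [folklore] -/
theorem sum_cdist_le_of_dist_le {x x₀ : UT N} {r : ℕ} (hx : dist x x₀ ≤ r) :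
    ∑ μ, circAbs (N μ) (((UT.toSite N x μ).val : ℤ) - ((UT.toSite N x₀ μ).val : ℤ)) ≤ d * r := by
  calc ∑ μ, circAbs (N μ) (((UT.toSite N x μ).val : ℤ) - ((UT.toSite N x₀ μ).val : ℤ)) ≤ ∑ _μ : Fin d, (r : ℤ) :=
        Finset.sum_le_sum fun μ _ => cdist_le_of_dist_le hx μ
    _ = d * r := by rw [Finset.sum_const, Finset.card_univ, Fintype.card_fin]; simp

/-! ## §2 One step towards the centre -/

/-- **A unit step towards the centre**: if the circular ℓ¹-distance `Σ_μ δ_μ(x, x₀)` is positive, there is a bond `b` of the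
torus with `x` at one end whose other end `x′` has `Σ_μ δ_μ(x′, x₀) = Σ_μ δ_μ(x, x₀) − 1` (step `±e_μ` along an axis with
`δ_μ ≥ 1`, `circAbs_descent`). [folklore] -/
theorem exists_step_down {x x₀ : UT N}
    (hpos : 1 ≤ ∑ μ, circAbs (N μ) (((UT.toSite N x μ).val : ℤ) - ((UT.toSite N x₀ μ).val : ℤ))) :
    ∃ (b : UT N × Fin d) (x' : UT N), ((bsrc b = x' ∧ btgt b = x) ∨ (bsrc b = x ∧ btgt b = x')) ∧
      ∑ μ, circAbs (N μ) (((UT.toSite N x' μ).val : ℤ) - ((UT.toSite N x₀ μ).val : ℤ)) =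
        ∑ μ, circAbs (N μ) (((UT.toSite N x μ).val : ℤ) - ((UT.toSite N x₀ μ).val : ℤ)) - 1 := by
  -- an axis with a positive circular distance
  have hex : ∃ μ, 1 ≤ circAbs (N μ) (((UT.toSite N x μ).val : ℤ) - ((UT.toSite N x₀ μ).val : ℤ)) := by
    by_contra hne
    push Not at hne
    have : ∑ μ, circAbs (N μ) (((UT.toSite N x μ).val : ℤ) - ((UT.toSite N x₀ μ).val : ℤ)) ≤ 0 :=
      Finset.sum_nonpos fun μ _ => by have := hne μ; omega
    omega
  obtain ⟨μ, hμ⟩ := hex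
  set g : UT N → Fin d → ℤ := fun y ν => circAbs (N ν) (((UT.toSite N y ν).val : ℤ) - ((UT.toSite N x₀ ν).val : ℤ)) with hg
  have hsplit : ∀ y, ∑ ν, g y ν = g y μ + ∑ ν ∈ univ.erase μ, g y ν := fun y =>
    (Finset.add_sum_erase _ _ (mem_univ μ)).symm
  rcases circAbs_descent (UT.one_le N μ) _ hμ with hup | hdn
  · -- step `+e_μ`: the bond `(x, μ)` from `x` to `x + e_μ`
    refine ⟨(x, μ), up x μ, Or.inr ⟨rfl, rfl⟩, ?_⟩
    show ∑ ν, g (up x μ) ν = ∑ ν, g x ν - 1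
    rw [hsplit (up x μ), hsplit x]
    have hrest : ∑ ν ∈ univ.erase μ, g (up x μ) ν = ∑ ν ∈ univ.erase μ, g x ν :=
      Finset.sum_congr rfl fun ν hν => by simp only [hg]; rw [cdist_up_ne x x₀ (ne_of_mem_erase hν)]
    have hmain : g (up x μ) μ = g x μ - 1 := by simp only [hg]; rw [cdist_up_self, hup]
    rw [hrest, hmain]; ring
  · -- step `−e_μ`: the bond `(x − e_μ, μ)` from `x − e_μ` to `x`
    refine ⟨(dn x μ, μ), dn x μ, Or.inl ⟨rfl, ?_⟩, ?_⟩
    · show up (dn x μ) μ = x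
      exact up_dn x μ
    show ∑ ν, g (dn x μ) ν = ∑ ν, g x ν - 1
    rw [hsplit (dn x μ), hsplit x]
    have hrest : ∑ ν ∈ univ.erase μ, g (dn x μ) ν = ∑ ν ∈ univ.erase μ, g x ν :=
      Finset.sum_congr rfl fun ν hν => by simp only [hg]; rw [cdist_dn_ne x x₀ (ne_of_mem_erase hν)]
    have hmain : g (dn x μ) μ = g x μ - 1 := by simp only [hg]; rw [cdist_dn_self, hdn]
    rw [hrest, hmain]; ring

/-! ## §3 The box lies in the scale-adapted ball (general graded scale `n = L^e` on the torus) -/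

variable (n : UT N → ℕ)

/-- **The grading bounds the scale from below near the centre**: with `n = L^e`, `1 ≤ L`, `0 < R` and the additive datum
`|e(y) − e(x₀)| ≤ A + d_n(y, x₀)/R`, every `y` with `d_n(y, x₀) ≤ ρ₀` has `n(x₀) ≤ L^A·e^{(log L/R)ρ₀}·n(y)`. [folklore] -/
theorem scale_ge_of_sdist_le {L : ℕ} (hL : 1 ≤ L) (e : UT N → ℕ) (hn : ∀ x, n x = L ^ e x) {R : ℝ} (hR : 0 < R) {A : ℕ}
    {y x₀ : UT N} (hadd : |(e y : ℝ) - e x₀| ≤ A + sdist bsrc btgt n y x₀ / R) {ρ₀ : ℝ}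
    (hy : sdist bsrc btgt n y x₀ ≤ ρ₀) :
    (n x₀ : ℝ) ≤ (L : ℝ) ^ A * Real.exp (Real.log L / R * ρ₀) * n y := by
  have h := scale_le_scale_mul_exp_add bsrc btgt n hL e hn (A := A) hadd
  have hL1 : (1 : ℝ) ≤ L := by exact_mod_cast hL
  have ht : 0 ≤ Real.log L / R := div_nonneg (Real.log_nonneg hL1) hR.le
  have hexp : Real.exp (Real.log L / R * sdist bsrc btgt n y x₀) ≤ Real.exp (Real.log L / R * ρ₀) :=
    Real.exp_le_exp.mpr (mul_le_mul_of_nonneg_left hy ht)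
  have hny : (0 : ℝ) ≤ n y := Nat.cast_nonneg _
  calc (n x₀ : ℝ) ≤ (L : ℝ) ^ A * n y * Real.exp (Real.log L / R * sdist bsrc btgt n y x₀) := h
    _ ≤ (L : ℝ) ^ A * n y * Real.exp (Real.log L / R * ρ₀) := by gcongr
    _ = (L : ℝ) ^ A * Real.exp (Real.log L / R * ρ₀) * n y := by ring

/-- **INDUCTION ON THE CIRCULAR ℓ¹-DISTANCE**: with `Γ = L^A·e^{(log L/R)ρ₀}`, `1 ≤ n`, for every `m` with `m·Γ/n(x₀) ≤ ρ₀`: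
every `x` with `Σ_μ δ_μ(x, x₀) ≤ m` has `d_n(x, x₀) ≤ m·Γ/n(x₀)` (peel one step with `exists_step_down`; the one-bond Lipschitz
bound of `MultiscaleDistance` costs `≤ 1/n(x′)`, and `1/n(x′) ≤ Γ/n(x₀)` by `scale_ge_of_sdist_le` since `x′` is already in the
`ρ₀`-ball by induction). [cite: Balaban1984PropagatorsII, (2.46) p.231] [folklore] -/
theorem sdist_le_of_sum_cdist_le (hn1 : ∀ x, 1 ≤ n x) {L : ℕ} (hL : 1 ≤ L) (e : UT N → ℕ) (hn : ∀ x, n x = L ^ e x)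
    {R : ℝ} (hR : 0 < R) {A : ℕ} (x₀ : UT N) (hadd : ∀ y, |(e y : ℝ) - e x₀| ≤ A + sdist bsrc btgt n y x₀ / R) {ρ₀ : ℝ} :
    ∀ m : ℕ, (m : ℝ) * ((L : ℝ) ^ A * Real.exp (Real.log L / R * ρ₀)) / n x₀ ≤ ρ₀ → ∀ x : UT N,
      ∑ μ, circAbs (N μ) (((UT.toSite N x μ).val : ℤ) - ((UT.toSite N x₀ μ).val : ℤ)) ≤ m →
      sdist bsrc btgt n x x₀ ≤ (m : ℝ) * ((L : ℝ) ^ A * Real.exp (Real.log L / R * ρ₀)) / n x₀ := by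
  set Γ : ℝ := (L : ℝ) ^ A * Real.exp (Real.log L / R * ρ₀) with hΓ
  have hΓ0 : 0 ≤ Γ := mul_nonneg (pow_nonneg (Nat.cast_nonneg _) _) (Real.exp_pos _).le
  have hn0 : (0 : ℝ) < n x₀ := by exact_mod_cast hn1 x₀
  intro m
  induction m with
  | zero =>
    intro _ x hx
    -- `Σ δ_μ ≤ 0` forces `x = x₀`
    have hall : ∀ μ, circAbs (N μ) (((UT.toSite N x μ).val : ℤ) - ((UT.toSite N x₀ μ).val : ℤ)) = 0 := by
      intro μ
      have h0 : ∀ ν, 0 ≤ circAbs (N ν) (((UT.toSite N x ν).val : ℤ) - ((UT.toSite N x₀ ν).val : ℤ)) := fun ν =>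
        circAbs_nonneg (UT.one_le N ν) _
      have hle : ∑ ν, circAbs (N ν) (((UT.toSite N x ν).val : ℤ) - ((UT.toSite N x₀ ν).val : ℤ)) ≤ 0 := by exact_mod_cast hx
      exact (Finset.sum_eq_zero_iff_of_nonneg (fun ν _ => h0 ν)).mp
        (le_antisymm hle (Finset.sum_nonneg fun ν _ => h0 ν)) μ (mem_univ μ)
    rw [eq_of_cdist_eq_zero hall, sdist_self]
    simp
  | succ m ih =>
    intro hm x hx
    have hm' : (m : ℝ) * Γ / n x₀ ≤ ρ₀ := by
      refine le_trans ?_ hm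
      push_cast
      gcongr
      linarith
    by_cases hle : ∑ μ, circAbs (N μ) (((UT.toSite N x μ).val : ℤ) - ((UT.toSite N x₀ μ).val : ℤ)) ≤ m
    · refine (ih hm' x hle).trans ?_
      push_cast
      gcongr
      linarith
    · -- the sum is exactly `m + 1 ≥ 1`: peel one step
      push Not at hle
      have heq : ∑ μ, circAbs (N μ) (((UT.toSite N x μ).val : ℤ) - ((UT.toSite N x₀ μ).val : ℤ)) = m + 1 := by
        push_cast at hx; omega
      obtain ⟨b, x', hb, hsum⟩ := exists_step_down (x := x) (x₀ := x₀) (by omega)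
      have hx' : ∑ μ, circAbs (N μ) (((UT.toSite N x' μ).val : ℤ) - ((UT.toSite N x₀ μ).val : ℤ)) ≤ m := by
        rw [hsum, heq]; omega
      have hd' := ih hm' x' hx'
      -- `x′` is in the `ρ₀`-ball, so `1/n(x′) ≤ Γ/n(x₀)`
      have hball : sdist bsrc btgt n x' x₀ ≤ ρ₀ := hd'.trans hm'
      have hsc := scale_ge_of_sdist_le n hL e hn hR (hadd x') hball
      have hnx' : (0 : ℝ) < n x' := by exact_mod_cast hn1 x'
      have hinv : ((n x' : ℝ))⁻¹ ≤ Γ / n x₀ := by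
        rw [inv_le_iff_one_le_mul₀ hnx', div_mul_eq_mul_div, one_le_div hn0]
        simpa only [hΓ] using hsc
      -- the one-bond Lipschitz step
      have hstep : sdist bsrc btgt n x x₀ ≤ ((n x' : ℝ))⁻¹ + sdist bsrc btgt n x' x₀ := by
        rcases hb with ⟨hs, ht⟩ | ⟨hs, ht⟩
        · have h1 := sdist_tgt_le bsrc btgt n b x₀
          rw [ht, hs] at h1
          have h2 := slen_le_left n x' x
          linarith
        · have h1 := sdist_src_le bsrc btgt n b x₀
          rw [ht, hs] at h1
          have h2 := slen_le_right n x x'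
          linarith
      calc sdist bsrc btgt n x x₀ ≤ ((n x' : ℝ))⁻¹ + sdist bsrc btgt n x' x₀ := hstep
        _ ≤ Γ / n x₀ + (m : ℝ) * Γ / n x₀ := add_le_add hinv hd'
        _ = ((m + 1 : ℕ) : ℝ) * Γ / n x₀ := by push_cast; ring

/-- **A COORDINATE BOX LIES IN THE SCALE-ADAPTED BALL**: with `Γ = L^A·e^{(log L/R)ρ₀}`, if `dist(x, x₀) ≤ r` and
`d·r·Γ/n(x₀) ≤ ρ₀` then `d_n(x, x₀) ≤ d·r·Γ/n(x₀)` (≤ ρ₀). [cite: Balaban1984PropagatorsII, (2.46) p.231] [folklore] -/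
theorem sdist_le_of_dist_le (hn1 : ∀ x, 1 ≤ n x) {L : ℕ} (hL : 1 ≤ L) (e : UT N → ℕ) (hn : ∀ x, n x = L ^ e x)
    {R : ℝ} (hR : 0 < R) {A : ℕ} (x₀ : UT N) (hadd : ∀ y, |(e y : ℝ) - e x₀| ≤ A + sdist bsrc btgt n y x₀ / R) {ρ₀ : ℝ}
    (r : ℕ) (hr : (d * r : ℕ) * ((L : ℝ) ^ A * Real.exp (Real.log L / R * ρ₀)) / n x₀ ≤ ρ₀) {x : UT N}
    (hx : dist x x₀ ≤ r) :
    sdist bsrc btgt n x x₀ ≤ (d * r : ℕ) * ((L : ℝ) ^ A * Real.exp (Real.log L / R * ρ₀)) / n x₀ :=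
  sdist_le_of_sum_cdist_le n hn1 hL e hn hR x₀ hadd (d * r) hr x (by
    have := sum_cdist_le_of_dist_le (N := N) hx; push_cast; exact this)

end Torus

end

end Summit.QuantumFields.BalabanUV.Beta.MultiscaleBoxDistance
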